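import Mathlib
import HarnessLib
import Summits.HubbardSuperconductivity.HubbardSuperconductivity.Theorems.KLProgrammeKLRegimeSplitTwoLegSizesMSChainStep
import Summits.HubbardSuperconductivity.HubbardSuperconductivity.Theorems.KLProgrammeKLRegimeSplitTwoLegSizesMSDiffProfileSizes

/-!
# Route `KLProgramme`, crux K3 — gen-5 ENGINE child (stmt-…-19918, `stub_twoLeg_step`, clause `TwoLegSizesMST`), recipe (L)+(F):
# THE TERM TABLE — centred angular sizes of ALL profiles of the MS witness ((P4-c), step 4d)

Seat hubbard-kl-k3c3-p1 (g3).  The witness profiles of `twoLegSizesMST_succ_of_chain_sizes` are `msProfile μ S d Kp n N m`: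
the base `m = n ↦ S∘γ[msChain 0]`, the slots `m ∈ Ioc n N ↦ S∘γ[msChain (m−n)] − S∘γ[msChain (m−n−1)]`, `0` otherwise.  This file
tabulates their CENTRED angular sizes `msGs` — the `hGs` input of that theorem — from: the symbol sizes `|S| ≤ M 0`, `‖Dᵏ evalM S‖ ≤ M k`
(`1 ≤ k ≤ 5`); the chain regime of `chain_curve_sizes` (budget `A`, `A₃`, `A₄`, `Dt_min`); and ANY high-part sizes `e m j` of the deep pieces
(`‖Dʲ evalM (highPart d (Kp m))‖ ≤ e m j`).  Base: `bellCum M msD j` (`curveProfile_centred_sizes`); slot `m`: `bellDiffCum M msD (msdD … (e m)) j`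
(`comp_sub_centred_sizes` + `chain_step_curve_diff`); `msD = (·, klCurveD1, klCurveD2, klCurveD3 A₃, klCurveD4 A₃ A₄, 0, …)` the common curve tower.
Definitions are explicit bookkeeping only; proofs only; nothing about the model.
-/

noncomputable section

namespace Summit.HubbardSuperconductivity.HubbardSuperconductivity.Theorems.KLRegimeSplit

set_option linter.dupNamespace false -- summit = problem name (single-conjunct summit), D-0017
set_option maxSynthPendingDepth 4 -- nested operator-norm instances (symbol sizes up to order five), as in `…CompDiff`

open Real Finset Literature.MathematicalPhysics.QuantumLattice Literature.MathematicalPhysics.QuantumLattice.BandSectorCounting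
open Summit.HubbardSuperconductivity.HubbardSuperconductivity.Theorems.DispersionFlow
open Summit.HubbardSuperconductivity.HubbardSuperconductivity.Theorems.PerturbedFermiCurve

/-! ## §1 The table -/

/-- The common curve tower of the chain frames (`chain_curve_sizes`), as a function of the order. -/
def msD (A₃ A₄ : ℝ) : ℕ → ℝ
  | 1 => klCurveD1
  | 2 => klCurveD2
  | 3 => klCurveD3 A₃
  | 4 => klCurveD4 A₃ A₄
  | _ => 0

/-- **THE TERM TABLE** `msGs`: base `m = n ↦ bellCum`, slots `m ∈ Ioc n N ↦ bellDiffCum` with the step differences `msdD … (e m)`, else `0`. -/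
def msGs (M : ℕ → ℝ) (A A₃ A₄ Dt : ℝ) (e : ℕ → ℕ → ℝ) (n N m j : ℕ) : ℝ :=
  if m = n then bellCum M (msD A₃ A₄) j
  else if m ∈ Ioc n N then bellDiffCum M (msD A₃ A₄) (msdD A A₃ A₄ Dt (e m)) j else 0

/-- **THE MEAN TABLE** `msMean`: `|mean| ≤ M 0` for the base profile, `≤ M 1 · msdD 0` (symbol Lipschitz × Fermi-point distance) for a slot, else `0`. -/
def msMean (M : ℕ → ℝ) (A A₃ A₄ Dt : ℝ) (e : ℕ → ℕ → ℝ) (n N m : ℕ) : ℝ :=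
  if m = n then M 0 else if m ∈ Ioc n N then M 1 * msdD A A₃ A₄ Dt (e m) 0 else 0

/-- Beyond order four the step differences repeat the order-four entry. -/
theorem msdD_add_five (A A₃ A₄ Dt : ℝ) (e : ℕ → ℝ) (i : ℕ) : msdD A A₃ A₄ Dt e (i + 5) = msdD A A₃ A₄ Dt e 4 := rfl

/-! ## §2 The sizes -/

section Table

variable (d : ℕ) {Kp : ℕ → TrigPolyC4v} {n N : ℕ} (hnN : n ≤ N) {a : ℕ → ℕ → ℝ}
  (ha : ∀ m ≤ N, ∀ j ≤ 4, ∀ q : Momentum, ‖iteratedFDeriv ℝ j (evalM (Kp m)) q‖ ≤ a m j)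

/-- A curve profile is the `Momentum` symbol along the `toLp` curve, pointwise. -/
theorem curveProfile_apply (μ : ℝ) (S C : TrigPolyC4v) (θ : ℝ) :
    curveProfile μ S C θ = evalM S (WithLp.toLp 2 (klFermiPoint μ C θ)) := by
  simp [curveProfile, evalM]

include hnN ha in
/-- **CENTRED ANGULAR SIZES OF ALL WITNESS PROFILES.**  See the module docstring. -/
theorem msProfile_centred_sizes {A : ℝ} (hA : ∀ j ≤ 2, chainSizeSum Kp a n N j ≤ A) (hA20 : A ≤ 1 / 20)
    (hd : klCurveD ≤ (bandBounds (show (-4 : ℝ) < -1.1 by norm_num) (show (-1.1 : ℝ) ≤ -0.1 by norm_num)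
      (show (-0.1 : ℝ) < 0 by norm_num)).Dtmin - 2 * A)
    {μ : ℝ} (hlo : (-1.1 : ℝ) ≤ μ - A) (hhi : μ + A ≤ -0.1)
    {A₃ A₄ : ℝ} (hA₃ : chainSizeSum Kp a n N 3 ≤ A₃) (hA₄ : chainSizeSum Kp a n N 4 ≤ A₄)
    (S : TrigPolyC4v) {M : ℕ → ℝ} (hMnn : ∀ k, 0 ≤ M k) (hM0 : ∀ q : Momentum, |evalM S q| ≤ M 0)
    (hM : ∀ k, 1 ≤ k → k ≤ 5 → ∀ q : Momentum, ‖iteratedFDeriv ℝ k (evalM S) q‖ ≤ M k)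
    {e : ℕ → ℕ → ℝ} (he : ∀ m ∈ Ioc n N, ∀ j ≤ 4, ∀ q : Momentum, ‖iteratedFDeriv ℝ j (evalM (highPart d (Kp m))) q‖ ≤ e m j)
    (m : ℕ) {j : ℕ} (hj : j ≤ 4) {i : ℕ} (hi : i ≤ j) (t : ℝ) :
    ‖iteratedFDeriv ℝ i (fun t => msProfile μ S d Kp n N m t - klAngularMean (msProfile μ S d Kp n N m)) t‖ ≤
      msGs M A A₃ A₄ ((bandBounds (show (-4 : ℝ) < -1.1 by norm_num) (show (-1.1 : ℝ) ≤ -0.1 by norm_num)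
        (show (-0.1 : ℝ) < 0 by norm_num)).Dtmin) e n N m j := by
  set B := bandBounds (show (-4 : ℝ) < -1.1 by norm_num) (show (-1.1 : ℝ) ≤ -0.1 by norm_num) (show (-0.1 : ℝ) < 0 by norm_num)
    with hBdef
  -- the common curve tower, in the `iteratedDeriv` key, for every chain frame
  have hDk : ∀ k ≤ N - n, ∀ i, 1 ≤ i → i ≤ 4 → ∀ θ,
      ‖iteratedDeriv i (fun θ : ℝ => (WithLp.toLp 2 (klFermiPoint μ (msChain d Kp n N k) θ) : Momentum)) θ‖ ≤ msD A₃ A₄ i := by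
    intro k hk i hi1 hi4 θ
    obtain ⟨-, -, d1, d2, d3, d4⟩ := chain_curve_sizes d hnN ha hA hA20 hd hlo hhi hA₃ hA₄ hk θ
    rw [← norm_iteratedFDeriv_eq_norm_iteratedDeriv]
    interval_cases i
    · exact d1
    · exact d2
    · exact d3
    · exact d4
  have hCk : ∀ k ≤ N - n, ContDiff ℝ 4 (fun θ : ℝ => (WithLp.toLp 2 (klFermiPoint μ (msChain d Kp n N k) θ) : Momentum)) :=
    fun k hk => (chain_curve_sizes d hnN ha hA hA20 hd hlo hhi hA₃ hA₄ hk 0).1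
  have hDnn : ∀ i, 0 ≤ msD A₃ A₄ i := by
    intro i
    rcases i with _ | _ | _ | _ | _ | i
    · simp [msD]
    · exact (norm_nonneg _).trans (hDk 0 (by omega) 1 le_rfl (by norm_num) 0)
    · exact (norm_nonneg _).trans (hDk 0 (by omega) 2 (by norm_num) (by norm_num) 0)
    · exact (norm_nonneg _).trans (hDk 0 (by omega) 3 (by norm_num) (by norm_num) 0)
    · exact (norm_nonneg _).trans (hDk 0 (by omega) 4 (by norm_num) (by norm_num) 0)
    · simp [msD]
  by_cases hm : m = n
  · -- the base profile
    subst hm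
    have hp : msProfile μ S d Kp m N m = curveProfile μ S (msChain d Kp m N 0) := by
      funext θ; simp [msProfile]
    rw [hp, msGs, if_pos rfl]
    exact curveProfile_centred_sizes μ S (msChain d Kp m N 0) (hCk 0 (by omega)) hMnn hDnn hM0
      (fun k hk1 hk4 q => hM k hk1 (by omega) q) (hDk 0 (by omega)) hj hi t
  by_cases hmem : m ∈ Ioc n N
  · -- a slot profile: one chain step
    set k := m - n with hkdef
    have hk1 : 1 ≤ k := by have := (Finset.mem_Ioc.mp hmem).1; omega
    have hk : k ≤ N - n := by have := (Finset.mem_Ioc.mp hmem).2; omega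
    have hmk : m = n + k := by have := (Finset.mem_Ioc.mp hmem).1; omega
    have hp : msProfile μ S d Kp n N m = fun θ =>
        evalM S (WithLp.toLp 2 (klFermiPoint μ (msChain d Kp n N k) θ)) -
          evalM S (WithLp.toLp 2 (klFermiPoint μ (msChain d Kp n N (k - 1)) θ)) := by
      funext θ; simp [msProfile, hm, hmem, curveProfile_apply, hkdef]
    rw [hp, msGs, if_neg hm, if_pos hmem]
    have he' : ∀ j ≤ 4, ∀ q : Momentum, ‖iteratedFDeriv ℝ j (evalM (highPart d (Kp (n + k)))) q‖ ≤ e m j := by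
      rw [← hmk]; exact he m hmem
    have hstep := chain_step_curve_diff d hnN ha hA hA20 hd hlo hhi hA₃ hA₄ hk1 hk he'
    have hdDnn : ∀ i, 0 ≤ msdD A A₃ A₄ B.Dtmin (e m) i := by
      intro i
      rcases i with _ | _ | _ | _ | _ | i
      · exact (norm_nonneg _).trans (hstep 0).1
      · exact (norm_nonneg _).trans ((hstep 0).2 1 le_rfl (by norm_num))
      · exact (norm_nonneg _).trans ((hstep 0).2 2 (by norm_num) (by norm_num))
      · exact (norm_nonneg _).trans ((hstep 0).2 3 (by norm_num) (by norm_num))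
      · exact (norm_nonneg _).trans ((hstep 0).2 4 (by norm_num) (by norm_num))
      · rw [msdD_add_five]; exact (norm_nonneg _).trans ((hstep 0).2 4 (by norm_num) (by norm_num))
    exact comp_sub_centred_sizes (F := evalM S) (contDiff_evalM S) (hCk (k - 1) (by omega)) (hCk k hk) hMnn hDnn hdDnn hM
      (hDk (k - 1) (by omega)) (hDk k hk) (fun θ => (hstep θ).1) (fun i hi1 hi4 θ => (hstep θ).2 i hi1 hi4) hj hi t
  · -- no profile
    rw [msProfile_of_not_mem hm hmem, msGs, if_neg hm, if_neg hmem, klAngularMean_zero]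
    simp

include hnN ha in
/-- **MEANS OF ALL WITNESS PROFILES** (the `j = 0` constant entries of the fits). -/
theorem abs_klAngularMean_msProfile_le {A : ℝ} (hA : ∀ j ≤ 2, chainSizeSum Kp a n N j ≤ A) (hA20 : A ≤ 1 / 20)
    (hd : klCurveD ≤ (bandBounds (show (-4 : ℝ) < -1.1 by norm_num) (show (-1.1 : ℝ) ≤ -0.1 by norm_num)
      (show (-0.1 : ℝ) < 0 by norm_num)).Dtmin - 2 * A)
    {μ : ℝ} (hlo : (-1.1 : ℝ) ≤ μ - A) (hhi : μ + A ≤ -0.1)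
    {A₃ A₄ : ℝ} (hA₃ : chainSizeSum Kp a n N 3 ≤ A₃) (hA₄ : chainSizeSum Kp a n N 4 ≤ A₄)
    (S : TrigPolyC4v) {M : ℕ → ℝ} (hMnn : ∀ k, 0 ≤ M k) (hM0 : ∀ q : Momentum, |evalM S q| ≤ M 0)
    (hM : ∀ k, 1 ≤ k → k ≤ 5 → ∀ q : Momentum, ‖iteratedFDeriv ℝ k (evalM S) q‖ ≤ M k)
    {e : ℕ → ℕ → ℝ} (he : ∀ m ∈ Ioc n N, ∀ j ≤ 4, ∀ q : Momentum, ‖iteratedFDeriv ℝ j (evalM (highPart d (Kp m))) q‖ ≤ e m j)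
    (m : ℕ) :
    |klAngularMean (msProfile μ S d Kp n N m)| ≤
      msMean M A A₃ A₄ ((bandBounds (show (-4 : ℝ) < -1.1 by norm_num) (show (-1.1 : ℝ) ≤ -0.1 by norm_num)
        (show (-0.1 : ℝ) < 0 by norm_num)).Dtmin) e n N m := by
  by_cases hm : m = n
  · subst hm
    rw [msMean, if_pos rfl]
    refine abs_klAngularMean_le' fun θ => ?_
    simp only [msProfile, if_true, curveProfile_apply]
    exact hM0 _
  by_cases hmem : m ∈ Ioc n N
  · set k := m - n with hkdef
    have hk1 : 1 ≤ k := by have := (Finset.mem_Ioc.mp hmem).1; omega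
    have hk : k ≤ N - n := by have := (Finset.mem_Ioc.mp hmem).2; omega
    have hmk : m = n + k := by have := (Finset.mem_Ioc.mp hmem).1; omega
    rw [msMean, if_neg hm, if_pos hmem]
    have he' : ∀ j ≤ 4, ∀ q : Momentum, ‖iteratedFDeriv ℝ j (evalM (highPart d (Kp (n + k)))) q‖ ≤ e m j := by
      rw [← hmk]; exact he m hmem
    have hstep := chain_step_curve_diff d hnN ha hA hA20 hd hlo hhi hA₃ hA₄ hk1 hk he'
    have hM₁ : ∀ z : Momentum, ‖fderiv ℝ (evalM S) z‖ ≤ M 1 := fun z => by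
      rw [norm_fderiv_eq_norm_iteratedFDeriv_one]; exact hM 1 le_rfl (by norm_num) z
    refine abs_klAngularMean_le' fun θ => ?_
    have hp : msProfile μ S d Kp n N m θ = evalM S (WithLp.toLp 2 (klFermiPoint μ (msChain d Kp n N k) θ)) -
        evalM S (WithLp.toLp 2 (klFermiPoint μ (msChain d Kp n N (k - 1)) θ)) := by
      simp [msProfile, hm, hmem, curveProfile_apply, hkdef]
    rw [hp]
    have h := (convex_univ).norm_image_sub_le_of_norm_fderiv_le (𝕜 := ℝ) (f := evalM S)
      (fun z _ => ((contDiff_evalM S (k := 1)).differentiable one_ne_zero) z) (fun z _ => hM₁ z)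
      (Set.mem_univ (WithLp.toLp 2 (klFermiPoint μ (msChain d Kp n N (k - 1)) θ) : Momentum))
      (Set.mem_univ (WithLp.toLp 2 (klFermiPoint μ (msChain d Kp n N k) θ) : Momentum))
    rw [Real.norm_eq_abs] at h
    exact h.trans (mul_le_mul_of_nonneg_left (hstep θ).1 (hMnn 1))
  · rw [msProfile_of_not_mem hm hmem, msMean, if_neg hm, if_neg hmem, klAngularMean_zero, abs_zero]

end Table

end Summit.HubbardSuperconductivity.HubbardSuperconductivity.Theorems.KLRegimeSplit

end
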